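import Mathlib
import Literature.NumberTheory.LFunctions.Zhang2022.TypedSection05C
import Literature.NumberTheory.LFunctions.Zhang2022.Section5LFunctionDiscGrowth
import Literature.NumberTheory.LFunctions.DirichletLogDerivDisc
import HarnessLib

/-!
# Zhang (2022) §5, (5.16): the node `Typed.Section05C.Eq516` DISCHARGED — the local partial-fraction
# formula for `L′/L(s′,ψ)` on the unit disc about `s′`, at the manuscript's parameters

Topic `Literature/NumberTheory/LFunctions/Zhang2022` (Landau–Siegel adjudication tree;
verdict-neutral). Y. Zhang, *Discrete mean estimates and the Landau–Siegel zero*,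
arXiv:2211.02515v1 (2022) [Zhang2022LandauSiegel], §5 p. 29–30, proof of Lemma 5.9, (5.16)
(tex L1638; DAG node `Z22:(5.16)`):

> It is known that `(L′/L)(s′,ψ) = Σ_{|ρ−s′|<1} 1/(s′−ρ) + O(1/α)`
> for `|Re s′ − 1/2| ≤ α` and `|Im s′ − 2πt₀| < 𝓛₁ + 10`, where `ρ` runs through the zeros of `L(s,ψ)`.

The typed node is `Typed.Section05C.Eq516` (`TypedSection05C.lean`, multiplicities `analyticOrderNatAt`,
`ψ ∈ Ψ₁`, under the blanket (A)). It is the classical local partial fraction (Montgomery–Vaughan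
Lemma 12.6) at the manuscript's parameters; the campaign's FACT-LIST (row F-18) classes it as a
CLAIM to be discharged from the tree, not a fact. The tree proves the DISC form about `2 + it`
with zeros in `|ρ − (2+it)| ≤ 81/50` (`DirichletDisc.exists_norm_logDeriv_sub_sum_le`), from the
bound `‖L‖ ≤ q‖s‖Z` on `σ ≥ 1/4`. The printed window `|ρ − s′| < 1` about `s′ ≈ 1/2 + it` reaches
`Re ρ > −1/2`, so this file re-runs the same argument (Titchmarsh §3.9 Lemma α,
`Literature.Analysis.Complex.norm_logDeriv_sub_sum_le`, radii `38/25 < 8/5 < 27/10 < 3`, and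
Mathlib's Jensen inequality at radius `27/10` inside `3`) with a polynomial bound for `L(z,ψ)` on
the whole disc `|z − (2+it)| ≤ 3` (`Section5LFunctionDiscGrowth.lean`: the functional equation
`L(z,ψ) = Z(z,ψ)L(1−z,ψ̄)` and Stirling's formula for `ϑ` on `Re z < 1/4`):

* (growth, in `Section5LFunctionDiscGrowth.lean`) `DiscGrowth.norm_LFunction_le_on_disc_three` —
  for `θ` primitive mod `k ≠ 1`, `t ≥ 160`, `|z − (2+it)| ≤ 3`: `‖L(z,θ)‖ ≤ 4Z·k³(t+6)³`;
* `Typed.Section05C.norm_logDeriv_sub_sum_unitDisc_le` — for `χ ≠ χ₀` mod `q`, a bound `B ≥ 1` for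
  `‖L(·,χ)‖` on `|z − (2+it)| ≤ 3`, `|s − (2+it)| ≤ 38/25`, `L(s,χ) ≠ 0`:
  `‖L′/L(s,χ) − Σ_{|ρ−s|<1} m(ρ)/(s−ρ)‖ ≤ 3500·log(2B)`;
* `Typed.Section05C.eq516_holds : Typed.Section05C.Eq516` — with `C = 3500(log(8Z) + 9)π`, `D ≥ ⌈e³⌉`
  (`p < 2P`, `Im s′ ≤ 8𝓛⁵¹⁹` ⇒ `log(2B) ≤ (log 8Z + 9)𝓛⁹ = (log 8Z + 9)π/α`).

No new definitions, no new named facts; nothing here bears on Theorems 1–2 of the source or on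
the cell's verdict on (8.24). `Z = DirichletDisc.Zc = Σ n^{−5/4}`.

## References

* Y. Zhang, arXiv:2211.02515v1 (2022), §5 Lemma 5.9 (proof), (5.16), pp. 29–30.
  [cite: Zhang2022LandauSiegel, (5.16) p.29]
* H. L. Montgomery, R. C. Vaughan, *Multiplicative Number Theory I*, CUP 2007, Lemma 12.6,
  Thm. 10.13. [cite: MontgomeryVaughan2007, Lemma 12.6]
* E. C. Titchmarsh, *The Theory of the Riemann Zeta-Function*, 2nd ed., OUP 1986, §3.9 Lemma α,
  §4.12 (4.12.3). [cite: Titchmarsh1986, §3.9 Lemma α]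
-/

noncomputable section

open Complex Real Set Metric Filter Topology MeromorphicOn

namespace Literature.NumberTheory.LFunctions.Zhang2022.Typed.Section05C

open Literature.NumberTheory.LFunctions.Zhang2022.Skeleton

/-! ## §1. Lemma α on the discs `38/25 < 8/5 < 27/10 < 3` about `2 + it`, and the unit disc -/

/-- The zeros of `L(s,χ)` (`χ ≠ χ₀`) in the open unit disc about any `s` form a finite set.
[folklore] -/
private theorem setOf_zeros_near_finite {q : ℕ} [NeZero q] (χ : DirichletCharacter ℂ q) (hχ : χ ≠ 1)
    (s : ℂ) : {ρ : ℂ | ‖ρ - s‖ < 1 ∧ χ.LFunction ρ = 0}.Finite := by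
  have hfin := (divisor χ.LFunction (closedBall s 1)).finiteSupport (isCompact_closedBall s 1)
  refine hfin.subset fun ρ hρ => ?_
  obtain ⟨h1, h2⟩ := hρ
  have hmem : ρ ∈ closedBall s 1 := by rw [mem_closedBall, dist_eq_norm]; exact h1.le
  rw [Function.mem_support,
    divisor_apply (DirichletDisc.analyticOnNhd_LFunction χ hχ _ _).meromorphicOn hmem,
    DirichletDisc.meromorphicOrderAt_untop₀_eq_zeroOrder χ hχ]
  have := (DirichletDisc.zeroOrder_pos_iff χ hχ ρ).2 h2
  exact_mod_cast this.ne'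

/-- **The local partial fraction on the unit disc** (MV Lemma 12.6 / Titchmarsh §3.9 Lemma α):
for `χ ≠ χ₀` mod `q`, `B ≥ 1` with `‖L(z,χ)‖ ≤ B` on `|z − (2+it)| ≤ 3`, `|s − (2+it)| ≤ 38/25`
(which covers `1/2 − 1/50 ≤ Re s`, `Im s = t`), `L(s,χ) ≠ 0`, and `S` the finite set of zeros `ρ`
with `|ρ − s| < 1`:
`‖L′/L(s,χ) − Σ_{ρ∈S} m(ρ)/(s−ρ)‖ ≤ 3500·log(2B)` (`m` = `analyticOrderNatAt`). Lemma α with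
radii `38/25 < 8/5 < 27/10 < 3` gives the sum over the zeros in `|ρ − (2+it)| ≤ 27/10` (which
contains `S`); the zeros there outside `S` are at distance `≥ 1` from `s` and their number is
bounded by Jensen at radius `27/10` inside `3` (`≤ 10·log(2B)`, `‖L(2+it,χ)‖ ≥ 1/2`).
[cite: Titchmarsh1986, §3.9 Lemma α] -/
theorem norm_logDeriv_sub_sum_unitDisc_le {q : ℕ} [NeZero q] (χ : DirichletCharacter ℂ q)
    (hχ : χ ≠ 1) (t : ℝ) {B : ℝ} (hB : 1 ≤ B)
    (hbound : ∀ z ∈ closedBall (2 + (t : ℂ) * I) 3, ‖χ.LFunction z‖ ≤ B)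
    {s : ℂ} (hs : s ∈ closedBall (2 + (t : ℂ) * I) (38 / 25)) (hLs : χ.LFunction s ≠ 0)
    (S : Finset ℂ) (hS : ∀ ρ, ρ ∈ S ↔ ‖ρ - s‖ < 1 ∧ χ.LFunction ρ = 0) :
    ‖logDeriv χ.LFunction s - ∑ ρ ∈ S, (analyticOrderNatAt χ.LFunction ρ : ℂ) / (s - ρ)‖ ≤
      3500 * Real.log (2 * B) := by
  classical
  -- abbreviations
  obtain ⟨c, hc⟩ : ∃ c : ℂ, c = 2 + (t : ℂ) * I := ⟨_, rfl⟩
  rw [← hc] at hbound hs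
  have hLc : χ.LFunction c ≠ 0 := by rw [hc]; exact DirichletDisc.LFunction_two_add_ne_zero χ t
  have hLc2 : 1 / 2 ≤ ‖χ.LFunction c‖ := by
    rw [hc]; exact DirichletDisc.half_le_norm_LFunction_two_add χ t
  have han : ∀ R : ℝ, AnalyticOnNhd ℂ χ.LFunction (closedBall c R) :=
    fun R => DirichletDisc.analyticOnNhd_LFunction χ hχ c R
  set D := divisor χ.LFunction (closedBall c (27 / 10)) with hD
  have hfinD : (Function.support D).Finite := D.finiteSupport (isCompact_closedBall c (27 / 10))
  set Z : Finset ℂ := hfinD.toFinset with hZ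
  have hD0 : ∀ u, 0 ≤ D u := fun u => (han (27 / 10)).divisor_nonneg u
  have hDeq : ∀ u ∈ closedBall c (27 / 10), D u = (DirichletDisc.zeroOrder χ u : ℤ) := by
    intro u hu
    rw [hD, divisor_apply (han _).meromorphicOn hu,
      DirichletDisc.meromorphicOrderAt_untop₀_eq_zeroOrder χ hχ]
  have hmemZ : ∀ u, u ∈ Z ↔ u ∈ closedBall c (27 / 10) ∧ χ.LFunction u = 0 := by
    intro u
    rw [hZ, Set.Finite.mem_toFinset, Function.mem_support]
    constructor
    · intro h
      have hu : u ∈ closedBall c (27 / 10) := D.supportWithinDomain (Function.mem_support.2 h)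
      refine ⟨hu, ?_⟩
      rw [hDeq u hu] at h
      have h' : 0 < DirichletDisc.zeroOrder χ u := by
        rcases Nat.eq_zero_or_pos (DirichletDisc.zeroOrder χ u) with h0 | h0
        · rw [h0] at h; simp at h
        · exact h0
      exact (DirichletDisc.zeroOrder_pos_iff χ hχ u).1 h'
    · rintro ⟨hu, h0⟩
      rw [hDeq u hu]
      have := (DirichletDisc.zeroOrder_pos_iff χ hχ u).2 h0
      exact_mod_cast this.ne'
  -- Lemma α
  have hα := Literature.Analysis.Complex.norm_logDeriv_sub_sum_le (f := χ.LFunction) (c := c)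
    (r := 38 / 25) (r₁ := 8 / 5) (R₂ := 27 / 10) (R := 3) (B := B)
    (by norm_num) (by norm_num) (by norm_num) (by norm_num) (han 3) hLc hbound hs hLs
  rw [← hD, ← hZ] at hα
  -- Jensen at radius `27/10` inside `3`
  have hJ := AnalyticOnNhd.sum_divisor_le (f := χ.LFunction) (c := c) (r := 27 / 10) (R := 3)
    (M := B) (by norm_num) (by norm_num) hB (by rw [abs_of_pos (by norm_num : (0 : ℝ) < 3)]; exact han 3)
    hLc (fun z hz => hbound z (by
      rw [abs_of_pos (by norm_num : (0 : ℝ) < 3)] at hz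
      exact sphere_subset_closedBall hz))
  rw [abs_of_pos (by norm_num : (0 : ℝ) < 27 / 10), ← hD] at hJ
  set N : ℝ := ∑ u ∈ Z, (D u : ℝ) with hN
  have hfs : ∑ᶠ u, D u = ∑ u ∈ Z, D u :=
    finsum_eq_sum_of_support_subset D (fun u hu => by rw [hZ, Set.Finite.coe_toFinset]; exact hu)
  have hNJ : N ≤ Real.log (B / ‖χ.LFunction c‖) / Real.log (3 / (27 / 10)) := by
    have : ((∑ᶠ u, D u : ℤ) : ℝ) = N := by rw [hfs, hN]; push_cast; rfl
    rw [← this]; exact hJ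
  have hN0 : 0 ≤ N := Finset.sum_nonneg fun u _ => by exact_mod_cast hD0 u
  -- numerical bounds
  have hB0 : 0 < B := by linarith
  have hlog2B : Real.log 2 ≤ Real.log (2 * B) := Real.log_le_log (by norm_num) (by linarith)
  have hl2 := Real.log_two_gt_d9
  have hlogB' : Real.log (B / ‖χ.LFunction c‖) ≤ Real.log (2 * B) := by
    refine Real.log_le_log (by positivity) ?_
    rw [div_le_iff₀ (by linarith)]
    nlinarith
  have hN10 : N ≤ 10 * Real.log (2 * B) := by
    have h109 : (1 : ℝ) / 10 ≤ Real.log (3 / (27 / 10)) := by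
      have := Real.one_sub_inv_le_log_of_pos (show (0 : ℝ) < 3 / (27 / 10) by norm_num)
      norm_num at this ⊢
      linarith
    have h1 : N ≤ Real.log (2 * B) / Real.log (3 / (27 / 10)) :=
      hNJ.trans (div_le_div_of_nonneg_right hlogB' (by linarith))
    rw [le_div_iff₀ (by linarith)] at h1
    nlinarith
  have hlog10 : Real.log (3 / (3 - 27 / 10)) ≤ 9 := by
    have := Real.log_le_sub_one_of_pos (show (0 : ℝ) < 3 / (3 - 27 / 10) by norm_num)
    norm_num at this ⊢
    linarith
  -- the unit disc: `S ⊆ Z`, and the zeros of `Z` outside `S` are at distance `≥ 1` from `s`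
  have hsc : ‖s - c‖ ≤ 38 / 25 := by rwa [mem_closedBall, dist_eq_norm] at hs
  have hSZ : S ⊆ Z := by
    intro ρ hρ
    obtain ⟨h1, h2⟩ := (hS ρ).1 hρ
    refine (hmemZ ρ).2 ⟨?_, h2⟩
    rw [mem_closedBall, dist_eq_norm]
    calc ‖ρ - c‖ = ‖(ρ - s) + (s - c)‖ := by ring_nf
      _ ≤ ‖ρ - s‖ + ‖s - c‖ := norm_add_le _ _
      _ ≤ 27 / 10 := by linarith
  have hsplit : ∑ u ∈ Z, (D u : ℂ) / (s - u) =
      (∑ u ∈ Z \ S, (D u : ℂ) / (s - u)) +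
        ∑ ρ ∈ S, (analyticOrderNatAt χ.LFunction ρ : ℂ) / (s - ρ) := by
    rw [← Finset.sum_sdiff hSZ]
    congr 1
    refine Finset.sum_congr rfl fun ρ hρ => ?_
    have hρc : ρ ∈ closedBall c (27 / 10) := ((hmemZ ρ).1 (hSZ hρ)).1
    rw [hDeq ρ hρc, DirichletDisc.zeroOrder]
    push_cast
    rfl
  have hfar : ‖∑ u ∈ Z \ S, (D u : ℂ) / (s - u)‖ ≤ N := by
    have hterm : ∀ u ∈ Z \ S, ‖(D u : ℂ) / (s - u)‖ ≤ (D u : ℝ) := by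
      intro u hu
      rw [Finset.mem_sdiff] at hu
      obtain ⟨huZ, huS⟩ := hu
      obtain ⟨-, hu0⟩ := (hmemZ u).1 huZ
      have hdist : 1 ≤ ‖s - u‖ := by
        by_contra hlt
        push Not at hlt
        exact huS ((hS u).2 ⟨by rwa [norm_sub_rev], hu0⟩)
      have hm0 : (0 : ℝ) ≤ D u := by exact_mod_cast hD0 u
      rw [norm_div, Complex.norm_intCast, abs_of_nonneg hm0]
      calc (D u : ℝ) / ‖s - u‖ ≤ (D u : ℝ) / 1 := div_le_div_of_nonneg_left hm0 one_pos hdist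
        _ = D u := div_one _
    calc ‖∑ u ∈ Z \ S, (D u : ℂ) / (s - u)‖ ≤ ∑ u ∈ Z \ S, ‖(D u : ℂ) / (s - u)‖ :=
          norm_sum_le _ _
      _ ≤ ∑ u ∈ Z \ S, (D u : ℝ) := Finset.sum_le_sum hterm
      _ ≤ N := Finset.sum_le_sum_of_subset_of_nonneg Finset.sdiff_subset
          fun u _ _ => by exact_mod_cast hD0 u
  -- assemble
  have hK : 2 * ((8 : ℝ) / 5) / ((27 / 10 - 8 / 5) * (8 / 5 - 38 / 25)) ≤ 37 := by norm_num
  have hmain : ‖logDeriv χ.LFunction s - ∑ u ∈ Z, (D u : ℂ) / (s - u)‖ ≤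
      37 * (Real.log (2 * B) + N * 9 + 1) := by
    refine hα.trans ?_
    have h1 : Real.log (B / ‖χ.LFunction c‖) + N * Real.log (3 / (3 - 27 / 10)) + 1 ≤
        Real.log (2 * B) + N * 9 + 1 := by
      have := mul_le_mul_of_nonneg_left hlog10 hN0
      linarith
    have h0 : 0 ≤ Real.log (B / ‖χ.LFunction c‖) + N * Real.log (3 / (3 - 27 / 10)) + 1 := by
      have hl : 0 ≤ Real.log (3 / (3 - 27 / 10)) := Real.log_nonneg (by norm_num)
      have hlB : 0 ≤ Real.log (B / ‖χ.LFunction c‖) := by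
        refine Real.log_nonneg ?_
        rw [le_div_iff₀ (by linarith)]
        have hcB : ‖χ.LFunction c‖ ≤ B := hbound c (mem_closedBall_self (by norm_num))
        linarith
      positivity
    calc 2 * ((8 : ℝ) / 5) / ((27 / 10 - 8 / 5) * (8 / 5 - 38 / 25)) *
          (Real.log (B / ‖χ.LFunction c‖) + N * Real.log (3 / (3 - 27 / 10)) + 1)
        ≤ 37 * (Real.log (B / ‖χ.LFunction c‖) + N * Real.log (3 / (3 - 27 / 10)) + 1) :=
          mul_le_mul_of_nonneg_right hK h0
      _ ≤ 37 * (Real.log (2 * B) + N * 9 + 1) := by gcongr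
  calc ‖logDeriv χ.LFunction s - ∑ ρ ∈ S, (analyticOrderNatAt χ.LFunction ρ : ℂ) / (s - ρ)‖
      = ‖(logDeriv χ.LFunction s - ∑ u ∈ Z, (D u : ℂ) / (s - u)) +
          ∑ u ∈ Z \ S, (D u : ℂ) / (s - u)‖ := by rw [hsplit]; ring_nf
    _ ≤ ‖logDeriv χ.LFunction s - ∑ u ∈ Z, (D u : ℂ) / (s - u)‖ +
          ‖∑ u ∈ Z \ S, (D u : ℂ) / (s - u)‖ := norm_add_le _ _
    _ ≤ 37 * (Real.log (2 * B) + N * 9 + 1) + N := add_le_add hmain hfar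
    _ ≤ 3500 * Real.log (2 * B) := by nlinarith

/-! ## §2. The bookkeeping at the manuscript's parameters and the discharge of `Eq516` -/

/-- The window `p ∼ P`: `P < p < 2P` (indeed `p < P(1 + 𝓛⁻⁶⁸)`), for `𝓛 ≥ 1`.
[cite: Zhang2022LandauSiegel, §2 p. 4] -/
theorem bigP_lt_p_lt_two_bigP {D : ℕ} (hD : 1 ≤ ell D) (x : Chr D) :
    bigP D < x.p ∧ (x.p : ℝ) < 2 * bigP D := by
  have hm := x.mem
  rw [primeWindow, Finset.mem_filter, Finset.mem_Ioo] at hm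
  have hP : 0 ≤ bigP D := (Real.exp_pos _).le
  have h1 : (x.p : ℝ) < bigP D * (1 + (ell D ^ 68)⁻¹) := Nat.lt_ceil.mp hm.1.2
  have h68 : (ell D ^ 68)⁻¹ ≤ 1 := inv_le_one_of_one_le₀ (one_le_pow₀ hD)
  refine ⟨(Nat.floor_lt hP).mp hm.1.1, h1.trans_le ?_⟩
  nlinarith

/-- The `t`-range of (5.16): `|t − 2πt₀| < 𝓛₁ + 10` (`t₀ = 𝓛⁵¹⁹`, `𝓛₁ = 𝓛⁴⁰⁵`, `𝓛 ≥ 3`) gives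
`160 ≤ t` and `t + 6 ≤ 𝓛¹⁰³⁸`. [cite: Zhang2022LandauSiegel, §2 (2.8)] -/
theorem t_range_516 {L t : ℝ} (hL : 3 ≤ L) (ht : |t - 2 * π * L ^ 519| < L ^ 405 + 10) :
    160 ≤ t ∧ t + 6 ≤ L ^ 1038 := by
  have hL1 : 1 ≤ L := by linarith
  have h405 : L ^ 405 + 10 ≤ L ^ 519 := by
    have h1 : (1 : ℝ) ≤ L ^ 405 := one_le_pow₀ hL1
    have h114 : (11 : ℝ) ≤ L ^ 114 := by
      have h : L ^ 3 ≤ L ^ 114 := pow_le_pow_right₀ hL1 (by norm_num)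
      have h3 : (27 : ℝ) ≤ L ^ 3 := by
        have := pow_le_pow_left₀ (by norm_num : (0 : ℝ) ≤ 3) hL 3
        norm_num at this
        exact this
      linarith
    calc L ^ 405 + 10 ≤ L ^ 405 * 11 := by nlinarith
      _ ≤ L ^ 405 * L ^ 114 := by gcongr
      _ = L ^ 519 := by rw [← pow_add]
  have h519 : (160 : ℝ) ≤ L ^ 519 := by
    have h : L ^ 5 ≤ L ^ 519 := pow_le_pow_right₀ hL1 (by norm_num)
    have h5 : (243 : ℝ) ≤ L ^ 5 := by
      have := pow_le_pow_left₀ (by norm_num : (0 : ℝ) ≤ 3) hL 5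
      norm_num at this
      exact this
    linarith
  obtain ⟨ht1, ht2⟩ := abs_lt.mp ht
  have hπa : 3 * L ^ 519 ≤ π * L ^ 519 :=
    mul_le_mul_of_nonneg_right Real.pi_gt_three.le (by positivity)
  have hπb : π * L ^ 519 ≤ 4 * L ^ 519 :=
    mul_le_mul_of_nonneg_right Real.pi_lt_four.le (by positivity)
  refine ⟨by linarith, ?_⟩
  have hsq : L ^ 1038 = L ^ 519 * L ^ 519 := by rw [← pow_add]
  rw [hsq]
  nlinarith

/-- **(5.16) is a theorem of the tree at the manuscript's parameters**: the node `Eq516` HOLDS,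
with `C = 3500(log 8Z + 9)π` and all `D ≥ ⌈e³⌉` (the (A) antecedent and `ψ ∈ Ψ₁` are not used:
the formula holds for every `ψ ∈ Ψ`). From `norm_logDeriv_sub_sum_unitDisc_le` at `t = Im s′`
with the growth bound `norm_LFunction_le_on_disc_three` (`k = p < 2P`, `Im s′ + 6 ≤ 𝓛¹⁰³⁸`, so
`log(2B) ≤ (log 8Z + 9)𝓛⁹ = (log 8Z + 9)π/α`). DAG node `Z22:(5.16)`.
[cite: Zhang2022LandauSiegel, (5.16) p.29] -/
theorem eq516_holds : Eq516 := by
  refine ⟨3500 * (Real.log (8 * DirichletDisc.Zc) + 9) * π, ⌈Real.exp 3⌉₊,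
    fun D _ χ hD _ _ _ x _ s' hσ hτ hLs => ?_⟩
  have hlog : 3 ≤ Real.log D := by
    have h : Real.exp 3 ≤ D := le_trans (Nat.le_ceil _) (by exact_mod_cast hD)
    exact (Real.le_log_iff_exp_le (lt_of_lt_of_le (Real.exp_pos _) h)).mpr h
  have hL : 3 ≤ ell D := hlog
  have hL1 : 1 ≤ ell D := by linarith
  have hL0 : 0 < ell D := by linarith
  have hα : alpha D = π / ell D ^ 9 := by rw [alpha, bigP, Real.log_exp]
  have hZ1 : 1 ≤ DirichletDisc.Zc := DirichletDisc.one_le_Zc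
  -- the parameters `p`, `t = Im s'`
  have hp1 : (1 : ℝ) ≤ x.p := by exact_mod_cast x.prime.one_lt.le
  have hp0 : (0 : ℝ) < x.p := by linarith
  obtain ⟨-, hp2⟩ := bigP_lt_p_lt_two_bigP hL1 x
  have hτ' : |s'.im - 2 * π * ell D ^ 519| < ell D ^ 405 + 10 := hτ
  obtain ⟨ht160, ht1038⟩ := t_range_516 hL hτ'
  have ht0 : 0 ≤ s'.im := by linarith
  -- the growth bound `B`
  obtain ⟨B, hB⟩ : ∃ B : ℝ, B = 4 * DirichletDisc.Zc * (x.p : ℝ) ^ 3 * (s'.im + 6) ^ 3 := ⟨_, rfl⟩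
  have hB1 : 1 ≤ B := by
    rw [hB]
    have h1 : (1 : ℝ) ≤ (x.p : ℝ) ^ 3 := one_le_pow₀ hp1
    have h2 : (1 : ℝ) ≤ (s'.im + 6) ^ 3 := one_le_pow₀ (by linarith)
    calc (1 : ℝ) = 1 * 1 * 1 * 1 := by ring
      _ ≤ 4 * DirichletDisc.Zc * (x.p : ℝ) ^ 3 * (s'.im + 6) ^ 3 :=
          mul_le_mul (mul_le_mul (mul_le_mul (by norm_num) hZ1 zero_le_one (by norm_num)) h1
            zero_le_one (by positivity)) h2 zero_le_one (by positivity)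
  have hbound : ∀ z ∈ closedBall (2 + (s'.im : ℂ) * I) 3, ‖x.ψ.LFunction z‖ ≤ B := by
    intro z hz
    rw [hB]
    exact DiscGrowth.norm_LFunction_le_on_disc_three x.prim x.p_ne_one ht160 hz
  -- `s'` lies in the disc `|s − (2 + i Im s')| ≤ 38/25`
  have hs : s' ∈ closedBall (2 + (s'.im : ℂ) * I) (38 / 25) := by
    rw [mem_closedBall, dist_eq_norm]
    have he : s' - (2 + (s'.im : ℂ) * I) = ((s'.re - 2 : ℝ) : ℂ) := by
      apply Complex.ext <;> simp
    rw [he, Complex.norm_real, Real.norm_eq_abs, abs_le]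
    obtain ⟨h1, h2⟩ := abs_le.mp hσ
    have hαs : alpha D ≤ 1 / 50 := by
      rw [hα, div_le_iff₀ (by positivity)]
      have h9 : (19683 : ℝ) ≤ ell D ^ 9 := by
        have := pow_le_pow_left₀ (by norm_num : (0 : ℝ) ≤ 3) hL 9
        norm_num at this
        exact this
      nlinarith [Real.pi_lt_four]
    constructor <;> linarith
  -- the finite set of zeros near `s'`
  have hfin : (zerosNear x s').Finite := setOf_zeros_near_finite x.ψ x.ψ_ne_one s'
  have hS : ∀ ρ, ρ ∈ finsetOf (zerosNear x s') ↔ ‖ρ - s'‖ < 1 ∧ x.ψ.LFunction ρ = 0 :=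
    fun ρ => by rw [mem_finsetOf hfin]; rfl
  have hmain := norm_logDeriv_sub_sum_unitDisc_le x.ψ x.ψ_ne_one s'.im hB1 hbound hs hLs
    (finsetOf (zerosNear x s')) hS
  -- `log(2B) ≤ (log 8Z + 9)𝓛⁹`
  have hlogp : Real.log (x.p : ℝ) ≤ ell D ^ 9 + 1 := by
    have hP0 : 0 < bigP D := Real.exp_pos _
    calc Real.log (x.p : ℝ) ≤ Real.log (2 * bigP D) := Real.log_le_log hp0 hp2.le
      _ = Real.log 2 + ell D ^ 9 := by rw [Real.log_mul two_ne_zero hP0.ne', bigP, Real.log_exp]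
      _ ≤ ell D ^ 9 + 1 := by linarith [Real.log_two_lt_d9]
  have hlogt : Real.log (s'.im + 6) ≤ ell D ^ 9 := by
    have h1 : Real.log (s'.im + 6) ≤ Real.log (ell D ^ 1038) :=
      Real.log_le_log (by linarith) ht1038
    have h2 : Real.log (ell D ^ 1038) = 1038 * Real.log (ell D) := Real.log_pow _ _
    have h3 : Real.log (ell D) ≤ ell D := (Real.log_le_sub_one_of_pos hL0).trans (by linarith)
    have h4 : 1038 * ell D ≤ ell D ^ 9 := by
      have h8 : (6561 : ℝ) ≤ ell D ^ 8 := by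
        have := pow_le_pow_left₀ (by norm_num : (0 : ℝ) ≤ 3) hL 8
        norm_num at this
        exact this
      calc 1038 * ell D ≤ ell D ^ 8 * ell D := by nlinarith
        _ = ell D ^ 9 := by ring
    nlinarith
  have hlog8Z : 0 ≤ Real.log (8 * DirichletDisc.Zc) := Real.log_nonneg (by linarith)
  have h9 : (1 : ℝ) ≤ ell D ^ 9 := one_le_pow₀ hL1
  have hlog2B : Real.log (2 * B) ≤ (Real.log (8 * DirichletDisc.Zc) + 9) * ell D ^ 9 := by
    have he : 2 * B = (8 * DirichletDisc.Zc) * ((x.p : ℝ) ^ 3 * (s'.im + 6) ^ 3) := by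
      rw [hB]; ring
    have h2 : Real.log ((x.p : ℝ) ^ 3 * (s'.im + 6) ^ 3) =
        3 * Real.log (x.p : ℝ) + 3 * Real.log (s'.im + 6) := by
      rw [Real.log_mul (by positivity) (by positivity), Real.log_pow, Real.log_pow]
      push_cast
      ring
    rw [he, Real.log_mul (by positivity) (by positivity), h2]
    nlinarith
  -- conclusion
  calc ‖logDeriv x.ψ.LFunction s' -
        ∑ ρ ∈ finsetOf (zerosNear x s'), (analyticOrderNatAt x.ψ.LFunction ρ : ℂ) / (s' - ρ)‖
      ≤ 3500 * Real.log (2 * B) := hmain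
    _ ≤ 3500 * ((Real.log (8 * DirichletDisc.Zc) + 9) * ell D ^ 9) := by gcongr
    _ = 3500 * (Real.log (8 * DirichletDisc.Zc) + 9) * π / alpha D := by
        rw [hα]; field_simp

end Literature.NumberTheory.LFunctions.Zhang2022.Typed.Section05C
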